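import Literature.MathematicalPhysics.QuantumFieldTheory.LatticeGauge
import Literature.MathematicalPhysics.QuantumFieldTheory.LatticeGaugePlaquetteLowerBound
import Literature.MathematicalPhysics.QuantumFieldTheory.LatticeGaugeStaticPotentialLimitProofs
import Literature.MathematicalPhysics.QuantumFieldTheory.LatticeGaugeStrongCouplingProofs
import HarnessLib

/-!
# The strong-coupling area law and string tension (S14): discharge of `osterwalder_seiler_areaLaw`

Sibling proofs file of `Literature.MathematicalPhysics.QuantumFieldTheory.LatticeGauge` closing the
named fact `osterwalder_seiler_areaLaw` (inventory item constructive-qft.S14; Osterwalder–Seiler,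
Ann. Phys. 110 (1978) 440, Thm. 5.1 with Thm. 3.1 and Lemma 5.2; Seiler LNP 159 Ch. 3; Wilson
1974): for `G = SU(N)`, `N ≥ 2`, fundamental representation, `d ≥ 2`, there are `β₀ > 0` and
`C > 0` with `C β₀ < 1` such that for `0 < β < β₀` every infinite-volume limit state `μ` of the
torus Wilson states satisfies the area law (`HasAreaLawState`) and has a string tension
`σ ≥ -log (C β)`.

## The assembly (`areaLaw_and_stringTension`, for every `SU(N)` Wilson model `ρ`)

* **Area law** (`LatticeGaugeTorusAreaLaw`): for `0 < β ≤ β₁ = betaOne d ρ` every limit state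
  satisfies `|W_μ(R,T)| ≤ K^{2(R+T)} (β/β₁)^{RT}`, i.e. `HasAreaLawWith μ χ K (-log (β/β₁))`
  (polymer expansion of the torus states + `N`-ality centre twist), so `C = 1/β₁`.
* **Uniqueness** (`LatticeGaugeStrongCouplingProofs`, OS78 Thms. 3.5–3.7): for `0 ≤ β < β₃` the
  limit state is unique, hence it is the limit of the *full* sequence of tori, in particular a
  limit along infinitely many even tori.
* **Reflection positivity** (`LatticeGaugeStaticPotentialLimitProofs`,
  `ConstructiveQFTWave0WilsonLoopRPProofs`; OS78 §2, Seiler LNP 159 §2): along infinitely many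
  even tori the limit loop expectations are non-negative and log-convex in the direction `0`,
  `W(R+1,T)² ≤ W(R,T) W(R+2,T)`; by the coordinate swap (`rectExpectation_eq_swap`, the swapped
  state being a limit along the same tori) also in the direction `1`.
* **Seed** (`LatticeGaugePlaquetteLowerBound`, first order of the strong-coupling expansion,
  OS78 §3): `W_μ(1,1) ≥ c β > 0` for `0 < β ≤ β₂`.
* **Propagation of positivity** (`StaticPotential.pos_of_logConvex`): `W(R,0) = W(0,T) = 1`,
  `W(1,1) > 0`, non-negativity and the two log-convexities give `W(R,T) > 0` for all `R, T`.
* **String tension** (`StringTension.hasStringTension_of_logConvex`, Seiler LNP 159 §2):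
  positivity, `W ≤ 1` and the two log-convexities give the static potentials and
  `σ = lim V(R)/R ≥ 0` (`HasStringTension`), and the area law bounds it from below,
  `σ ≥ -log (β/β₁) = -log (C β)` (`HasAreaLawWith.le_of_hasStringTension`).

With `β₀ = min (β₁/2) (min β₂ β₃)` all hypotheses hold for `0 < β < β₀`, and `C β₀ ≤ 1/2 < 1`.

## References

* K. Osterwalder, E. Seiler, *Gauge field theories on a lattice*, Ann. Phys. 110 (1978) 440,
  §2 (reflection positivity), §3 (strong coupling cluster expansion), §5 (Thm. 5.1: confinement
  of static quarks at strong coupling).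
* E. Seiler, *Gauge Theories as a Problem of Constructive Quantum Field Theory and Statistical
  Mechanics*, LNP 159 (1982), §2, Ch. 3.
* K. Wilson, *Confinement of quarks*, Phys. Rev. D 10 (1974) 2445.
* I. Montvay, G. Münster, *Quantum Fields on a Lattice* (1994), §3.4–3.5 (pp. 124, 149–153).

All statements here are proved. [folklore]
-/

noncomputable section

open MeasureTheory Filter Topology
open Literature.MathematicalPhysics.QuantumLattice Literature.Probability.LatticeModels

namespace Literature.MathematicalPhysics.QuantumFieldTheory

namespace AreaLawAssembly

variable {d N : ℕ} {G : Type*} [Group G] [TopologicalSpace G] [IsTopologicalGroup G]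
  [CompactSpace G] [MeasurableSpace G] [BorelSpace G] (ρ : G →* Matrix (Fin N) (Fin N) ℂ)

/-- Infinitely many of the tori `Λ_{k+1}` of the full sequence are even. [folklore] -/
theorem frequently_even_succ : ∃ᶠ k : ℕ in atTop, Even (id k + 1) := by
  refine Filter.frequently_atTop.2 fun a => ⟨2 * a + 1, by omega, ?_⟩
  exact ⟨a + 1, by show 2 * a + 1 + 1 = a + 1 + (a + 1); ring⟩

/-- **Positivity and string tension of a full-sequence limit state.** Let `G` be compact, `ρ` a
continuous `N`-dimensional representation (`N ≠ 0`), `d ≥ 2`, `β ≥ 0`, and let `μ` be the limit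
of the full sequence of torus Wilson states (`IsInfiniteVolumeLimitAlong ρ β id`). If the plaquette
expectation `W_μ(1,1)` is positive, then all rectangular loop expectations `W_μ(R,T)` are
positive and `μ` has a non-negative string tension (`HasStringTension`): reflection positivity of
the even tori gives non-negativity and log-convexity of `R ↦ W_μ(R,T)` in the limit
(`rectExpectation_nonneg_and_logConvex_of_frequently_even`), the coordinate swap transports them
to `T ↦ W_μ(R,T)`, positivity propagates from `W(0,·) = W(·,0) = 1` and `W(1,1) > 0`
(`StaticPotential.pos_of_logConvex`), and `StringTension.hasStringTension_of_logConvex`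
concludes (Seiler LNP 159 §2). [folklore] -/
theorem hasStringTension_of_isInfiniteVolumeLimit [NeZero d] (hd : 2 ≤ d) (hρ : Continuous ρ)
    (hN : N ≠ 0) {β : ℝ} (hβ : 0 ≤ β) {μ : Measure (LGConfig d G)}
    (hlimA : IsInfiniteVolumeLimitAlong ρ β id μ)
    (h11 : 0 < rectExpectation μ (fun g => normalisedCharacter N (ρ g)) 0 1 1 1) :
    (∀ R T, 0 < rectExpectation μ (fun g => normalisedCharacter N (ρ g)) 0 1 R T) ∧
      ∃ σ : ℝ, 0 ≤ σ ∧ HasStringTension μ (fun g => normalisedCharacter N (ρ g)) σ := by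
  set χ : G → ℝ := fun g => normalisedCharacter N (ρ g) with hχ
  have hχinv : ∀ g, χ g⁻¹ = χ g := fun g => by
    simp only [hχ, normalisedCharacter,
      Literature.RepresentationTheory.CompactGroups.CompactGroup.re_trace_map_inv ρ hρ]
  haveI : IsProbabilityMeasure μ := hlimA.1
  set μ' := μ.map (configPermZd (Equiv.swap (0 : Fin d) 1))
  have hlim' : IsInfiniteVolumeLimitAlong ρ β id μ' :=
    IsInfiniteVolumeLimitAlong.map_configPermZd ρ hρ hlimA _
  haveI : IsProbabilityMeasure μ' := hlim'.1
  have hpar : ∃ᶠ k : ℕ in atTop, Even (id k + 1) := frequently_even_succ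
  have hG := fun R T =>
    rectExpectation_nonneg_and_logConvex_of_frequently_even ρ hd hρ hβ strictMono_id hlimA hpar R T
  have hG' := fun R T =>
    rectExpectation_nonneg_and_logConvex_of_frequently_even ρ hd hρ hβ strictMono_id hlim' hpar R T
  have hswap : ∀ R T, rectExpectation μ χ 0 1 R T = rectExpectation μ' χ 0 1 T R := fun R T =>
    rectExpectation_eq_swap μ χ hχinv R T
  have hnn : ∀ R T, 0 ≤ rectExpectation μ χ 0 1 R T := fun R T => (hG T R).1
  have hR : ∀ R T, rectExpectation μ χ 0 1 (R + 1) T ^ 2 ≤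
      rectExpectation μ χ 0 1 R T * rectExpectation μ χ 0 1 (R + 2) T := fun R T => (hG T R).2
  have hT : ∀ R T, rectExpectation μ χ 0 1 R (T + 1) ^ 2 ≤
      rectExpectation μ χ 0 1 R T * rectExpectation μ χ 0 1 R (T + 2) := fun R T => by
    rw [hswap, hswap, hswap]
    exact (hG' R T).2
  have hR0 : ∀ T, rectExpectation μ χ 0 1 0 T = 1 := fun T =>
    rectExpectation_zero_eq_one ρ hN μ 0 1 T
  have hT0 : ∀ R, rectExpectation μ χ 0 1 R 0 = 1 := fun R => by
    rw [hswap]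
    exact rectExpectation_zero_eq_one ρ hN μ' 0 1 R
  have h1T : ∀ T, 0 < rectExpectation μ χ 0 1 1 T :=
    StaticPotential.pos_of_logConvex (W := fun T => rectExpectation μ χ 0 1 1 T)
      (by show 0 < rectExpectation μ χ 0 1 1 0; rw [hT0]; exact one_pos) h11 (fun T => hnn 1 T)
      (fun T => hT 1 T)
  have hpos : ∀ R T, 0 < rectExpectation μ χ 0 1 R T := fun R T =>
    StaticPotential.pos_of_logConvex (W := fun R => rectExpectation μ χ 0 1 R T)
      (by show 0 < rectExpectation μ χ 0 1 0 T; rw [hR0]; exact one_pos) (h1T T) (fun R => hnn R T)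
      (fun R => hR R T) R
  refine ⟨hpos, StringTension.hasStringTension_of_logConvex μ χ (fun R T _ _ => hpos R T)
    (fun R T _ _ => (le_abs_self _).trans (StringTension.abs_rectExpectation_le_one ρ hρ μ R T))
    (fun R T _ _ => hT R T) (fun R T _ _ => hR R T)⟩

/-- **Area law and string tension at strong coupling for `SU(N)` Wilson models** (Osterwalder–
Seiler 1978 Thm. 5.1; Seiler LNP 159 Ch. 3): for `ρ` an `SU(N)` model (`IsSpecialUnitaryModel`:
`G` compact, `ρ` continuous, injective, onto `SU(N)`), `N ≥ 2`, `d ≥ 2`, there are `β₀ > 0` and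
`C > 0` with `C β₀ < 1` such that for `0 < β < β₀` every `μ ∈ infiniteVolumeLimitPoints ρ β`
satisfies the area law for `χ = (1/N) Re tr ρ` and has a string tension `σ ≥ -log (C β)`.
See the module docstring for the assembly. [folklore] -/
theorem areaLaw_and_stringTension [NeZero d] [T2Space G] (hρ : IsSpecialUnitaryModel ρ)
    (hd : 2 ≤ d) (hN : 2 ≤ N) :
    ∃ β₀ C : ℝ, 0 < β₀ ∧ 0 < C ∧ C * β₀ < 1 ∧ ∀ β : ℝ, 0 < β → β < β₀ →
      ∀ μ ∈ infiniteVolumeLimitPoints (d := d) ρ β,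
        HasAreaLawState μ (fun g => normalisedCharacter N (ρ g)) ∧
          ∃ σ : ℝ, HasStringTension μ (fun g => normalisedCharacter N (ρ g)) σ
            ∧ -Real.log (C * β) ≤ σ := by
  haveI := IsSpecialUnitaryModel.secondCountableTopology ρ hρ
  obtain ⟨β₂, c, hβ₂0, -, hc0, hplaq⟩ :=
    PlaquetteLowerBound.exists_rectExpectation_one_one_ge ρ hρ hN hd
  obtain ⟨β₃, hβ₃0, hsc, -⟩ := osterwalder_seiler_strongCoupling_of_secondCountable (d := d) ρ hd hρ.1
  have hb1 : 0 < betaOne d ρ := betaOne_pos d (ρ := ρ)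
  refine ⟨min (betaOne d ρ / 2) (min β₂ β₃), 1 / betaOne d ρ,
    lt_min (by positivity) (lt_min hβ₂0 hβ₃0), by positivity, ?_, fun β hβ0 hβ μ hμ => ?_⟩
  · calc 1 / betaOne d ρ * min (betaOne d ρ / 2) (min β₂ β₃)
        ≤ 1 / betaOne d ρ * (betaOne d ρ / 2) :=
          mul_le_mul_of_nonneg_left (min_le_left _ _) (by positivity)
      _ = 1 / 2 := by field_simp
      _ < 1 := by norm_num
  · have hβ1 : β < betaOne d ρ :=
      lt_of_lt_of_le hβ ((min_le_left _ _).trans (by linarith))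
    have hβ2 : β ≤ β₂ := (hβ.trans_le ((min_le_right _ _).trans (min_le_left _ _))).le
    have hβ3 : β < β₃ := hβ.trans_le ((min_le_right _ _).trans (min_le_right _ _))
    refine ⟨TorusAreaLaw.hasAreaLawState_of_mem_infiniteVolumeLimitPoints ρ hρ hN hd hβ0 hβ1 hμ, ?_⟩
    have hA := TorusAreaLaw.hasAreaLawWith_of_mem_infiniteVolumeLimitPoints ρ hρ hN hd hβ0 hβ1.le hμ
    obtain ⟨μ₀, hμ₀, hpts⟩ := (hsc β hβ0.le hβ3).1
    have hμeq : μ = μ₀ := by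
      rw [hpts] at hμ
      exact hμ
    have hlimμ : IsInfiniteVolumeLimitAlong ρ β id μ := hμeq ▸ hμ₀
    have h11 : 0 < rectExpectation μ (fun g => normalisedCharacter N (ρ g)) 0 1 1 1 :=
      lt_of_lt_of_le (mul_pos hc0 hβ0) (hplaq β hβ0 hβ2 μ hμ)
    obtain ⟨-, σ, -, hσ⟩ :=
      hasStringTension_of_isInfiniteVolumeLimit ρ hd hρ.1 (by omega) hβ0.le hlimμ h11
    refine ⟨σ, hσ, ?_⟩
    have hlog : (1 / betaOne d ρ) * β = β / betaOne d ρ := by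
      rw [one_div, inv_mul_eq_div]
    rw [hlog]
    exact hA.le_of_hasStringTension hσ

end AreaLawAssembly

section Discharge

variable {d N : ℕ} [NeZero d]

/-- **Osterwalder–Seiler strong-coupling area law and string tension** — PROVED: the named fact
`osterwalder_seiler_areaLaw` of `LatticeGauge` (constructive-qft.S14; Osterwalder–Seiler, Ann.
Phys. 110 (1978) 440, Thm. 5.1 with Thm. 3.1 and Lemma 5.2; Seiler LNP 159 Ch. 3; Wilson 1974)
for `G = SU(N)`, `N ≥ 2`, in the fundamental representation and `d ≥ 2`, by
`AreaLawAssembly.areaLaw_and_stringTension` applied to the `SU(N)` model `fundamentalRep (Fin N)`.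
[cite: Wilson1974] -/
theorem osterwalder_seiler_areaLaw_holds : osterwalder_seiler_areaLaw d N :=
  fun hd hN => AreaLawAssembly.areaLaw_and_stringTension (fundamentalRep (Fin N))
    (TorusAreaLaw.isSpecialUnitaryModel_fundamentalRep N) hd hN

end Discharge

end Literature.MathematicalPhysics.QuantumFieldTheory
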